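import Summits.BirchSwinnertonDyer.Rank1Residual.Additive.SignedTwistMinusCorankBound
import HarnessLib

/-!
# B3's corank half as a CARDINALITY bound: `p^m ≤ #G` for every finite subgroup `G` of
# `H¹(ℚ_p, W[p^m])` containing the minus Kummer classes (cell `b2b-bsdres`, CLASS-CLOSURE lane,
# class O10 — x1b GEN 40, class lead; file 92 of the series)

HONEST FRAMING (cell `b2b-bsdres`, run/shared/lean/b2b/bsd-rank1-residual/, verbatim in every
file): the goal of the cell is to DELETE the COMBINATION-SHAPED residual classes of the
Birch–Swinnerton-Dyer formula for ALL analytic-rank `≤ 1` elliptic curves over `ℚ` — "full BSD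
formula for every rank `≤ 1` curve in class `C`" assembled STRICTLY from published theorems — so
that the rank-`≤ 1` remainder becomes exactly the CONSTRUCTION-SHAPED classes, which are TYPED
(missing-input `Prop`s), NOT attempted. This is not "finishing BSD". CLASS-CLOSURE lane: prove
what is provable now; shrink each hard class to its core with data; no claim beyond stated classes;
research routes on CONSTRUCTION-SHAPED X12 / O10; census / instrument output = EVIDENCE / conjecture
items, NEVER a Literature fact; `RESIDUAL-MAP.md` marks change only by signed lines. THIS FILE:
TOOL THEOREMS ONLY — no definition, no named Literature fact, no `sorry`, axioms standard; nothing
is booked; no label / mark / count / sub-cell moves; (C1_η), (C2_η-GZ), (C3_η) stay typed as filed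
(cc-typer-6's pen); nothing about `BSD(W, p)` of any pair is claimed.

## What

File 91 gives `p^m` DISTINCT classes of `H¹(ℚ_p, W[p^m])` restricting on `Gal(ℚ̄_p/ℚ_n·ℚ_p)` to
Kummer cocycles of `p^m`-th roots of zero-clause minus points (`2m ≤ n + 1`). This file restates it
in the shape consumed by the finite-group algebra of B3 (x1b GEN 39 file 83,
`TransverseLine.sup_eq_top_and_card_eq`: "`#S ≥ p^m`"): for EVERY finite additive subgroup `G` of
`H¹(ℚ_p, W[p^m])` containing all such classes — whatever receptacle `Σ_m` the count (C) adopts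
(x1b GEN 39 note §3 (iv), typer ask (α)) — **`p^m ≤ #G`**; generic tower hypotheses
(`pow_le_natCard_of_forall_minus_mem`) and Kobayashi's setting (`…_cyclotomic`).

References: [Kobayashi2003] S. Kobayashi, Invent. Math. 152 (2003), Thm. 6.2 (p. 11), Prop. 8.7
(p. 16), Prop. 8.12 (p. 17), Lemma 8.17 (p. 19).
-/

noncomputable section

open scoped Classical

open WeierstrassCurve Field

namespace Summit.BirchSwinnertonDyer.Rank1Residual.Additive.SignedTwist

open Literature.NumberTheory.EllipticCurves Literature.NumberTheory.GaloisRepresentations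
  Literature.NumberTheory.EllipticCurves.Kobayashi2003 Literature.NumberTheory.EllipticCurves.ZpDescent
  Summit.BirchSwinnertonDyer.Rank1Residual.AdditivePotMult
  Summit.BirchSwinnertonDyer.Rank1Residual.Additive.PadicCyclotomicTower
  ZpExtension
open scoped ContRepresentation

/-- A finset contained in a finite additive subgroup has at most `#G` elements. [folklore] -/
theorem finset_card_le_natCard {A : Type*} [AddCommGroup A] (G : AddSubgroup A) [Finite G]
    (Ξ : Finset A) (hΞ : ∀ ξ ∈ Ξ, ξ ∈ G) : Ξ.card ≤ Nat.card G := by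
  haveI := Fintype.ofFinite G
  let f : Ξ → G := fun ξ => ⟨ξ.1, hΞ ξ.1 ξ.2⟩
  have hf : Function.Injective f := fun a b h => Subtype.ext (congrArg (fun z : G => (z : A)) h)
  calc Ξ.card = Fintype.card Ξ := (Fintype.card_coe Ξ).symm
    _ ≤ Fintype.card G := Fintype.card_le_of_injective f hf
    _ = Nat.card G := Nat.card_eq_fintype_card.symm

section Generic

variable (W : WeierstrassCurve ℚ) [W.IsElliptic] (K₀ : Type) [Field K₀] [NumberField K₀] {θ : K₀} {c : ℚ}
  (hθ : θ ∉ Set.range (algebraMap ℚ K₀)) (hc : θ ^ 2 = algebraMap ℚ K₀ c)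
  {p : ℕ} [hp : Fact p.Prime] (κ : ZpExtension ℚ p)
  {V : WeierstrassCurve ℚ} [V.IsElliptic] {C : VariableChange ℚ} (hCV : C • W.quadraticTwist c = V)
  (η : absoluteGaloisGroup ℚ →* ℤˣ)
  (hη : ∀ σ : absoluteGaloisGroup ℚ, η σ = 1 ↔ σ • rootInClosure K₀ θ = rootInClosure K₀ θ)

include hθ hc hCV hη in
/-- **`p^m ≤ #G` for every finite subgroup `G ≤ H¹(ℚ_p, W[p^m])` containing the minus Kummer
classes** (those restricting on `Gal(ℚ̄_p/ℚ_n·ℚ_p)` to `u ↦ uR − R` with `p^m R` a zero-clause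
minus point of `W(ℚ_n·ℚ_p)`), `2m ≤ n + 1`; generic tower hypotheses of file 91.
[cite: Kobayashi2003, Thm. 6.2 (p. 11), Prop. 8.7 (p. 16), Prop. 8.12 (p. 17)] -/
theorem pow_le_natCard_of_forall_minus_mem
    (hD : ∀ g : absoluteGaloisGroup ℚ, ∃ τ : absoluteGaloisGroup ℚ_[p],
      (resGalOfEmb (closureEmb (K := ℚ) ℚ_[p]) τ)⁻¹ * g ∈ towerTopSubgroup κ K₀)
    (hκ₀ : ∀ x, ∃ g ∈ galRange (K := ℚ) K₀, κ g = x) [(galRange (K := ℚ) K₀).Normal]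
    (hidx : (galRange (K := ℚ) K₀).index ≤ p - 1) (hp2 : p ≠ 2)
    (M : WeierstrassCurve ℤ_[p]) [hE : (M.map PadicInt.Coe.ringHom).IsElliptic]
    [hEt : (M.map PadicInt.toZMod).IsElliptic]
    (htr : Literature.NumberTheory.EllipticCurves.HasseManin.tr (M.map PadicInt.toZMod) = 0)
    (hVM : M.baseChange (AlgebraicClosure ℚ_[p]) = V.baseChange (AlgebraicClosure ℚ_[p]))
    (hU : ∀ n, localSubgroupOfEmb (towerSubgroup κ K₀ n) (closureEmb (K := ℚ) ℚ_[p]) = stab p (n + 1))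
    {n m : ℕ} (hnm : 2 * m ≤ n + 1)
    (G : AddSubgroup (galoisCohomology
      (GaloisRep.restrictField ℚ_[p] (W.torsionGaloisModule ((p ^ m : ℕ) : ℤ))) 1)) [Finite G]
    (hG : ∀ ξ, (∃ x ∈ signedLocalPointsOfEmb κ (closureEmb (K := ℚ) ℚ_[p]) W (-1) n ⊓
          (localTraceOfEmb κ (closureEmb (K := ℚ) ℚ_[p]) W 0 n).ker,
        ∃ R : localPoints W ℚ_[p], ((p ^ m : ℕ) : ℤ) • R = x ∧
        ∃ φ : contOneCocycles (DiscreteGaloisModule.toTopRep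
            (GaloisRep.restrictField ℚ_[p] (W.torsionGaloisModule ((p ^ m : ℕ) : ℤ)))),
          oneCocycleClass _ φ = ξ ∧
          ∀ u ∈ localLayerSubgroupOfEmb κ (closureEmb (K := ℚ) ℚ_[p]) n,
            pointsMap W ℚ_[p] ((φ.1 u : geomTorsion W ((p ^ m : ℕ) : ℤ)) : geomPoints W) = u • R - R) →
        ξ ∈ G) :
    p ^ m ≤ Nat.card G := by
  obtain ⟨Ξ, hcard, hΞ⟩ := exists_finset_galoisCohomology_minus_of_le W K₀ hθ hc κ hCV η hη hD hκ₀
    hidx hp2 M htr hVM hU hnm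
  exact hcard.symm.le.trans (finset_card_le_natCard G Ξ fun ξ hξ => hG ξ (hΞ ξ hξ))

end Generic

section Cyclotomic

variable (W : WeierstrassCurve ℚ) [W.IsElliptic] {p : ℕ} [hp : Fact p.Prime] (κ : ZpExtension ℚ p)
  {V : WeierstrassCurve ℚ} [V.IsElliptic]
  (F : Type) [Field F] [NumberField F] [IsCyclotomicExtension {p} ℚ F]

include F in
/-- **`p^m ≤ #G`, Kobayashi's setting** (`F` a `p`-th cyclotomic field, `κ` cyclotomic,
`V = C • W^{(p*)}` with a good supersingular `a_p = 0` model, `p` odd, `2m ≤ n + 1`): every finite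
subgroup of `H¹(ℚ_p, W[p^m])` containing the minus Kummer classes has at least `p^m` elements.
[cite: Kobayashi2003, §3 p. 5, Thm. 6.2 (p. 11), Prop. 8.7 (p. 16), Prop. 8.12 (p. 17)] -/
theorem pow_le_natCard_of_forall_minus_mem_cyclotomic (hp2 : p ≠ 2) (hκ : κ.IsCyclotomic)
    (C : VariableChange ℚ) (hCV : C • W.quadraticTwist ((-1) ^ (p / 2) * p) = V)
    (M : WeierstrassCurve ℤ_[p]) [hE : (M.map PadicInt.Coe.ringHom).IsElliptic]
    [hEt : (M.map PadicInt.toZMod).IsElliptic]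
    (htr : Literature.NumberTheory.EllipticCurves.HasseManin.tr (M.map PadicInt.toZMod) = 0)
    (hVM : M.baseChange (AlgebraicClosure ℚ_[p]) = V.baseChange (AlgebraicClosure ℚ_[p]))
    {n m : ℕ} (hnm : 2 * m ≤ n + 1)
    (G : AddSubgroup (galoisCohomology
      (GaloisRep.restrictField ℚ_[p] (W.torsionGaloisModule ((p ^ m : ℕ) : ℤ))) 1)) [Finite G]
    (hG : ∀ ξ, (∃ x ∈ signedLocalPointsOfEmb κ (closureEmb (K := ℚ) ℚ_[p]) W (-1) n ⊓
          (localTraceOfEmb κ (closureEmb (K := ℚ) ℚ_[p]) W 0 n).ker,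
        ∃ R : localPoints W ℚ_[p], ((p ^ m : ℕ) : ℤ) • R = x ∧
        ∃ φ : contOneCocycles (DiscreteGaloisModule.toTopRep
            (GaloisRep.restrictField ℚ_[p] (W.torsionGaloisModule ((p ^ m : ℕ) : ℤ)))),
          oneCocycleClass _ φ = ξ ∧
          ∀ u ∈ localLayerSubgroupOfEmb κ (closureEmb (K := ℚ) ℚ_[p]) n,
            pointsMap W ℚ_[p] ((φ.1 u : geomTorsion W ((p ^ m : ℕ) : ℤ)) : geomPoints W) = u • R - R) →
        ξ ∈ G) :
    p ^ m ≤ Nat.card G := by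
  obtain ⟨Ξ, hcard, hΞ⟩ := exists_finset_galoisCohomology_minus_of_le_cyclotomic W κ F hp2 hκ C hCV M htr
    hVM hnm
  exact hcard.symm.le.trans (finset_card_le_natCard G Ξ fun ξ hξ => hG ξ (hΞ ξ hξ))

end Cyclotomic

end Summit.BirchSwinnertonDyer.Rank1Residual.Additive.SignedTwist

end
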